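import Summits.KontsevichZagierPeriods.Zeta5Search.Barrier.ConeGammaCuspSectionRays

/-!
# ζ(5) search — BARRIER: THE GLOBAL ASCENT MODULUS — one number per direction: `σ(δ) ≤ Λ·spread(δ)`, sharp, attained at a normalised ray

HONEST FRAMING (cell `pub-zeta5`): systematic search; no irrationality claim unless kernel-certified. MODEL objects
under Brown–Zudilin's (28)+(30) accounting ([BZ22] = arXiv:2210.03391; (28) observed, not proved); nothing here is a
statement about `ζ(5)`, any `γ` of record, the cone's supremum (C2 OPEN) or the value / sign of the cusp slope or of
the modulus at a named direction (DATA of the cell); no ray and no value at a named direction enters the kernel; S-E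
stays CONJECTURED; records in print UNMOVED. Prover P2 g36, item «THE GLOBAL ASCENT MODULUS» (P2 g35's successor menu
(a)), file (2) (theorems only).

THE POINT. P2 g35 decided a cusp top by finitely many signs (`σ ≤ 0` at the rays) and sized a FAILED chamber
certificate by the chamber ascent value `v(δ₀) ≥ 0`. This file collapses the whole first-order picture of a direction
`a` (period `T`) into ONE REAL NUMBER, the GLOBAL ASCENT MODULUS `Λ(a,T)` := the largest cusp slope of a NORMALISED
displacement (rates `r_k = φ_k/h_k(a)` in `[0, 1]`, one `0`, one `1`) — written out, no definition: `Λ = cuspSlope a T x`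
for the ray `x` of `exists_modulus_ray`. With the rate SPREAD `r_M(δ) − r_m(δ)` (`m` / `M` any slowest / fastest form
of `δ`):
* `abs_cuspSlope_le_mass_mul_spread` — A PRIORI `|σ(δ)| ≤ T·(2s₀ + 4Σ_j s_j)·spread(δ)` (P2 g30's transport form: `σ`
  is a non-negative combination of pair exchanges `r_k − r_l` of total mass `≤ T·Σ_{k∈F} h_k(a)`): the cusp slope is
  Lipschitz in the spread seminorm, so the modulus is finite with an explicit bound;
* **`exists_modulus_ray`** — THE MODULUS IS ATTAINED AT A NORMALISED RAY (any period pattern function `F`, any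
  extension): there is a normalised RAY `x` of the rate arrangement with `σ(δ) ≤ σ(x)·spread(δ)` for EVERY displacement
  `δ`; `σ(x)` is the LEAST such constant, the largest cusp slope of any normalised displacement, and `|σ(x)| ≤
  T·(2s₀ + 4Σ_j s_j)` (file (1)'s section theorem chamber by chamber + the finiteness of the normalised rays);
* **`forall_cuspSlope_nonpos_iff_modulus_nonpos`** — CUSP TOP ⇔ `Λ ≤ 0`; **`forall_cuspSlope_neg_iff_modulus_neg`** —
  STRICT cusp top (`σ < 0` off the radial line) ⇔ `Λ < 0`; hence **`exists_uniform_descent_of_strict`** — A STRICT CUSP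
  TOP IS UNIFORMLY STRICT: `σ(δ) ≤ −c·spread(δ)` with ONE `c > 0` (finiteness of the rays replaces compactness);
* `cuspSlope_le_max_modulus_zero_of_gaps_le_one` — `0 ∨ Λ` bounds every chamber ascent value of P2 g35 (the chamber
  polytope of `chamber_value_duality` has spread `≤ 1`), and `x` itself is feasible in its own chamber: the largest
  chamber value is `max(Λ, 0)`, and the two differ exactly at strict cusp tops;
* canonical forms (P2 g33's `F = Σ_b patternN_b`; hpos / hT / hper / hF only).
What stays DATA (`HOME/pub-zeta5-p2/g36/alg/`, exact LPs on P2 g34/g35's random chambers, seed 134): at record/41 · flag/60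
· argmax-120 · t*/480 the signed chamber values split `λ < 0 / = 0 / > 0` as `199/0/1 · 195/0/5 · 118/0/2 · 80/0/0` (no sampled
chamber is flat; every maximiser a normalised ray), `Λ/T ≥ 0.074 · 0.090 · 0.040 · 0.064` by located ascent rays (lower
bounds only; no enumeration), and the a-priori ceiling `2s₀ + 4Σ_j s_j ≈ 10.6–10.9` is `16–32×` the largest sampled
`|λ|/T` — the named directions are not cusp tops (known), nothing is claimed or certified there; nothing about `γ`, C2,
S-E or `ζ(5)`.
-/

noncomputable section

open Set MeasureTheory Finset
open scoped Topology

namespace Summit.KontsevichZagierPeriods.Zeta5Search.Barrier.ConeGamma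

/-! ### The a-priori bound: `σ` is Lipschitz in the spread -/

/-- **THE CUSP SLOPE IS LIPSCHITZ IN THE RATE SPREAD**: for all 28 forms of `a` positive, `T > 0` a period, every
displacement `δ` and every slowest / fastest pair `(m, M)` of its rates (`r_m(δ) ≤ r_k(δ) ≤ r_M(δ)` for all `k`):
`|cuspSlope a T δ| ≤ T·(2s₀ + 4Σ_j s_j)·(r_M(δ) − r_m(δ))` — by P2 g30's transport form `σ(δ) = Σ w_{kl}·(r_k(δ) −
r_l(δ))`, `w ≥ 0` of total mass `≤ T·Σ_{k∈F} h_k(a) = T·(2s₀ + 4Σ_j s_j)`, each exchange bounded by the spread. In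
particular the global ascent modulus is finite: `|Λ(a,T)| ≤ T·(2s₀ + 4Σ_j s_j)`. This is a CEILING from the transport
form, not a locator: at the four named directions it is `16–32×` the largest sampled `|λ(δ₀)|/T` (DATA, desk (M2)). -/
theorem abs_cuspSlope_le_mass_mul_spread {a : Dir} (hpos : ∀ k, 0 < h28 a k) {T : ℝ} (hT : 0 < T)
    (hper : ∀ k : Fin 28, ∃ z : ℤ, T * h28 a k = z) (δ : Fin 8 → ℝ) {m M : Fin 28}
    (hmM : ∀ k, phiForm δ m / h28 a m ≤ phiForm δ k / h28 a k ∧ phiForm δ k / h28 a k ≤ phiForm δ M / h28 a M) :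
    |cuspSlope a T δ| ≤
      T * (2 * sParam a 0 + 4 * ∑ j : Fin 7, sParam a j.succ) * (phiForm δ M / h28 a M - phiForm δ m / h28 a m) := by
  obtain ⟨-, -, -, w, -, hmass, -, hσ⟩ := cuspSlope_eq_transport hpos hT hper δ
  have hs : 0 ≤ phiForm δ M / h28 a M - phiForm δ m / h28 a m := by linarith [(hmM m).2]
  have hup : cuspSlope a T δ ≤ (∑ k, ∑ l, (w k l : ℝ)) * (phiForm δ M / h28 a M - phiForm δ m / h28 a m) := by
    rw [hσ, Finset.sum_mul]
    refine Finset.sum_le_sum fun k _ => ?_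
    rw [Finset.sum_mul]
    refine Finset.sum_le_sum fun l _ => mul_le_mul_of_nonneg_left ?_ (Nat.cast_nonneg _)
    linarith [(hmM k).2, (hmM l).1]
  have hlo : -((∑ k, ∑ l, (w k l : ℝ)) * (phiForm δ M / h28 a M - phiForm δ m / h28 a m)) ≤ cuspSlope a T δ := by
    rw [hσ, Finset.sum_mul, ← Finset.sum_neg_distrib]
    refine Finset.sum_le_sum fun k _ => ?_
    rw [Finset.sum_mul, ← Finset.sum_neg_distrib]
    refine Finset.sum_le_sum fun l _ => ?_
    rw [← mul_neg]
    refine mul_le_mul_of_nonneg_left ?_ (Nat.cast_nonneg _)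
    linarith [(hmM k).1, (hmM l).2]
  have hm := mul_le_mul_of_nonneg_right hmass hs
  rw [abs_le]
  exact ⟨by linarith, hup.trans hm⟩

/-! ### The global ascent modulus is attained at a normalised ray -/

/-- **THE GLOBAL ASCENT MODULUS IS ATTAINED AT A NORMALISED RAY** (any period pattern function `F`, any extension). All
28 forms of `a` positive, `T > 0` a period. There is a displacement `x`, NORMALISED (rates in `[0, 1]`, one rate `0`, one
rate `1`) and a RAY of the rate arrangement (two distinct rates, rigid tie pattern), such that
(i) `cuspSlope a T δ ≤ cuspSlope a T x · (r_M(δ) − r_m(δ))` for EVERY displacement `δ` and every slowest / fastest pair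
`(m, M)` of its rates — one number `Λ(a,T) := cuspSlope a T x` controls every first-order ascent through the spread;
(ii) `Λ` is the LEAST constant with (i); (iii) `Λ` is the largest cusp slope of any normalised displacement (the
modulus is a maximum over the unit-spread sphere of the quotient by `ℝ·s(a)`, attained at a vertex); (iv) `|Λ| ≤
T·(2s₀ + 4Σ_j s_j)` (`abs_cuspSlope_le_mass_mul_spread` — a ceiling, not a locator). PROOF SHAPE: the normalised rays form a finite non-empty set
(file (1)); `x` maximises `σ` on it; a `δ` of positive spread lies in the closed chamber of a generic `δ₀`, where `σ` is
the chamber functional `G_{δ₀}` (P2 g31, weights summing to `0`), and file (1)'s section theorem bounds `G_{δ₀}(δ)` by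
`G_{δ₀}(x₁)·spread(δ)` at a normalised ray `x₁` of that chamber, `σ(x₁) ≤ σ(x)`; a `δ` of spread `0` is radial, `σ(δ) =
0`. No value of `Λ` at a named direction is asserted. -/
theorem exists_modulus_ray {a : Dir} (hpos : ∀ k, 0 < h28 a k) {T : ℝ} (hT : 0 < T)
    (hper : ∀ k : Fin 28, ∃ z : ℤ, T * h28 a k = z)
    {M : ℕ → Finset (Fin 28)} {f : ℕ → Finset (Fin 28) → ℝ}
    (hf : ∀ m, m + 1 < (bkpts a T).card → ∀ Δ : Fin 8 → ℝ, (∀ k, |phiForm Δ k| < 1) →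
      (∀ k, |phiForm Δ k| < wallDist a T) →
        (torusN (bkpt a T m • sParam a + Δ) : ℝ) = f m ((M m).filter fun k => 0 ≤ phiForm Δ k))
    {F : Finset (Fin 28) → ℝ} (hF : ∀ A, F A = ∑ m ∈ Finset.range ((bkpts a T).card - 1), f m (A ∩ M m)) :
    ∃ x : Fin 8 → ℝ, (∀ k, 0 ≤ phiForm x k / h28 a k ∧ phiForm x k / h28 a k ≤ 1) ∧
      (∃ k l, phiForm x k / h28 a k = 0 ∧ phiForm x l / h28 a l = 1) ∧
      ((∃ k l, phiForm x k / h28 a k ≠ phiForm x l / h28 a l) ∧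
        ∀ d : Fin 8 → ℝ, (∀ k l, phiForm x k / h28 a k = phiForm x l / h28 a l →
          phiForm d k / h28 a k = phiForm d l / h28 a l) → ∃ u t : ℝ, d = u • x + t • sParam a) ∧
      (∀ δ : Fin 8 → ℝ, ∀ m M : Fin 28, (∀ k, phiForm δ m / h28 a m ≤ phiForm δ k / h28 a k ∧
          phiForm δ k / h28 a k ≤ phiForm δ M / h28 a M) →
        cuspSlope a T δ ≤ cuspSlope a T x * (phiForm δ M / h28 a M - phiForm δ m / h28 a m)) ∧
      (∀ c : ℝ, (∀ δ : Fin 8 → ℝ, ∀ m M : Fin 28, (∀ k, phiForm δ m / h28 a m ≤ phiForm δ k / h28 a k ∧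
            phiForm δ k / h28 a k ≤ phiForm δ M / h28 a M) →
          cuspSlope a T δ ≤ c * (phiForm δ M / h28 a M - phiForm δ m / h28 a m)) → cuspSlope a T x ≤ c) ∧
      (∀ y : Fin 8 → ℝ, (∀ k, 0 ≤ phiForm y k / h28 a k ∧ phiForm y k / h28 a k ≤ 1) →
        (∃ k l, phiForm y k / h28 a k = 0 ∧ phiForm y l / h28 a l = 1) → cuspSlope a T y ≤ cuspSlope a T x) ∧
      |cuspSlope a T x| ≤ T * (2 * sParam a 0 + 4 * ∑ j : Fin 7, sParam a j.succ) := by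
  classical
  -- the finite, non-empty set of normalised rays and a maximiser of `σ` on it
  obtain ⟨R, hR⟩ := exists_finset_normalised_rays hpos
  obtain ⟨δ₁, hgen₁, -⟩ := exists_generic_refines hpos (0 : Fin 8 → ℝ)
  obtain ⟨x₀, -, hx₀01, hx₀n, hx₀ray⟩ := exists_normalised_ray_refines hpos hgen₁
  have hRne : R.Nonempty := ⟨x₀, (hR x₀).mpr ⟨hx₀01, hx₀n, hx₀ray⟩⟩
  obtain ⟨x, hxR, hxmax⟩ := Finset.exists_max_image R (fun y => cuspSlope a T y) hRne
  obtain ⟨hx01, hxn, hxray⟩ := (hR x).mp hxR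
  -- (i) the modulus bound
  have hmod : ∀ δ : Fin 8 → ℝ, ∀ m M : Fin 28, (∀ k, phiForm δ m / h28 a m ≤ phiForm δ k / h28 a k ∧
      phiForm δ k / h28 a k ≤ phiForm δ M / h28 a M) →
      cuspSlope a T δ ≤ cuspSlope a T x * (phiForm δ M / h28 a M - phiForm δ m / h28 a m) := by
    intro δ m Mx hmM
    have hs : 0 ≤ phiForm δ Mx / h28 a Mx - phiForm δ m / h28 a m := by linarith [(hmM m).2]
    rcases hs.eq_or_lt with h | h
    · -- spread `0`: `δ` is radial
      have hall : ∀ k, phiForm δ k / h28 a k = phiForm δ m / h28 a m := fun k =>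
        le_antisymm (by linarith [(hmM k).2]) (hmM k).1
      rw [← h, mul_zero, eq_smul_sParam_of_forall_rate_eq hpos hall, cuspSlope_smul_sParam hpos hT hper]
    · -- positive spread: the chamber of a generic refinement, file (1)'s section theorem
      obtain ⟨δ₀, hgen, href⟩ := exists_generic_refines hpos δ
      obtain ⟨x₁, hx₁ref, hx₁01, hx₁n, hx₁ray, hx₁max⟩ :=
        exists_normalised_ray_max_section hpos hgen (period_greedy_sum_eq_zero hpos hT hper hf hF hgen)
      have h1 := hx₁max δ href m Mx hmM
      rw [← cuspSlope_eq_greedy_period_of_refines hpos hT hper hf hF hgen δ href,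
        ← cuspSlope_eq_greedy_period_of_refines hpos hT hper hf hF hgen x₁ hx₁ref] at h1
      have h2 : cuspSlope a T x₁ ≤ cuspSlope a T x := hxmax x₁ ((hR x₁).mpr ⟨hx₁01, hx₁n, hx₁ray⟩)
      exact h1.trans (mul_le_mul_of_nonneg_right h2 h.le)
  -- a slowest / fastest pair of a normalised displacement
  have hpair : ∀ y : Fin 8 → ℝ, (∀ k, 0 ≤ phiForm y k / h28 a k ∧ phiForm y k / h28 a k ≤ 1) →
      ∀ k l, phiForm y k / h28 a k = 0 → phiForm y l / h28 a l = 1 →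
      ∀ j, phiForm y k / h28 a k ≤ phiForm y j / h28 a j ∧ phiForm y j / h28 a j ≤ phiForm y l / h28 a l :=
    fun y hy k l hk hl j => by rw [hk, hl]; exact hy j
  obtain ⟨k₀, l₀, hk₀, hl₀⟩ := hxn
  refine ⟨x, hx01, ⟨k₀, l₀, hk₀, hl₀⟩, hxray, hmod, fun c hc => ?_, fun y hy01 hyn => ?_, ?_⟩
  · -- (ii) optimality: test the constant at `x` itself
    have h := hc x k₀ l₀ (hpair x hx01 k₀ l₀ hk₀ hl₀)
    rwa [hk₀, hl₀, sub_zero, mul_one] at h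
  · -- (iii) every normalised displacement
    obtain ⟨k, l, hk, hl⟩ := hyn
    have h := hmod y k l (hpair y hy01 k l hk hl)
    rwa [hk, hl, sub_zero, mul_one] at h
  · -- (iv) the a-priori bound at `x`
    have h := abs_cuspSlope_le_mass_mul_spread hpos hT hper x (hpair x hx01 k₀ l₀ hk₀ hl₀)
    rwa [hk₀, hl₀, sub_zero, mul_one] at h

/-! ### Reading the cusp off the modulus -/

/-- **CUSP TOP ⇔ `Λ ≤ 0`.** If `x` carries the modulus bound (`σ(δ) ≤ σ(x)·spread(δ)` for every `δ` and every slowest /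
fastest pair — (i) of `exists_modulus_ray`), then `σ ≤ 0` in EVERY direction iff `σ(x) ≤ 0`. (No hypothesis on the
direction: a statement about any real function `σ = cuspSlope a T` and any such `x`.) -/
theorem forall_cuspSlope_nonpos_iff_modulus_nonpos {a : Dir} {T : ℝ} {x : Fin 8 → ℝ}
    (hmod : ∀ δ : Fin 8 → ℝ, ∀ m M : Fin 28, (∀ k, phiForm δ m / h28 a m ≤ phiForm δ k / h28 a k ∧
        phiForm δ k / h28 a k ≤ phiForm δ M / h28 a M) →
      cuspSlope a T δ ≤ cuspSlope a T x * (phiForm δ M / h28 a M - phiForm δ m / h28 a m)) :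
    (∀ δ, cuspSlope a T δ ≤ 0) ↔ cuspSlope a T x ≤ 0 := by
  refine ⟨fun h => h x, fun hx δ => ?_⟩
  obtain ⟨m, -, hm⟩ := Finset.exists_min_image Finset.univ (fun k => phiForm δ k / h28 a k) Finset.univ_nonempty
  obtain ⟨M, -, hM⟩ := Finset.exists_max_image Finset.univ (fun k => phiForm δ k / h28 a k) Finset.univ_nonempty
  have hmM : ∀ k, phiForm δ m / h28 a m ≤ phiForm δ k / h28 a k ∧ phiForm δ k / h28 a k ≤ phiForm δ M / h28 a M :=
    fun k => ⟨hm k (Finset.mem_univ _), hM k (Finset.mem_univ _)⟩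
  exact (hmod δ m M hmM).trans (mul_nonpos_of_nonpos_of_nonneg hx (by linarith [(hmM m).2]))

/-- **STRICT CUSP TOP ⇔ `Λ < 0`.** If `x` carries the modulus bound and has two distinct rates (as the modulus ray of
`exists_modulus_ray` does), then `σ(δ) < 0` for every NON-RADIAL `δ` (two distinct rates) iff `σ(x) < 0`. -/
theorem forall_cuspSlope_neg_iff_modulus_neg {a : Dir} {T : ℝ} {x : Fin 8 → ℝ}
    (hx : ∃ k l, phiForm x k / h28 a k ≠ phiForm x l / h28 a l)
    (hmod : ∀ δ : Fin 8 → ℝ, ∀ m M : Fin 28, (∀ k, phiForm δ m / h28 a m ≤ phiForm δ k / h28 a k ∧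
        phiForm δ k / h28 a k ≤ phiForm δ M / h28 a M) →
      cuspSlope a T δ ≤ cuspSlope a T x * (phiForm δ M / h28 a M - phiForm δ m / h28 a m)) :
    (∀ δ : Fin 8 → ℝ, (∃ k l, phiForm δ k / h28 a k ≠ phiForm δ l / h28 a l) → cuspSlope a T δ < 0) ↔
      cuspSlope a T x < 0 := by
  refine ⟨fun h => h x hx, fun hxneg δ hδ => ?_⟩
  obtain ⟨m, -, hm⟩ := Finset.exists_min_image Finset.univ (fun k => phiForm δ k / h28 a k) Finset.univ_nonempty
  obtain ⟨M, -, hM⟩ := Finset.exists_max_image Finset.univ (fun k => phiForm δ k / h28 a k) Finset.univ_nonempty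
  have hmM : ∀ k, phiForm δ m / h28 a m ≤ phiForm δ k / h28 a k ∧ phiForm δ k / h28 a k ≤ phiForm δ M / h28 a M :=
    fun k => ⟨hm k (Finset.mem_univ _), hM k (Finset.mem_univ _)⟩
  have hs : 0 < phiForm δ M / h28 a M - phiForm δ m / h28 a m := by
    obtain ⟨k, l, hkl⟩ := hδ
    rcases (sub_nonneg.mpr (hmM m).2).eq_or_lt with h | h
    · exact absurd (le_antisymm (by linarith [(hmM k).2, (hmM l).1]) (by linarith [(hmM l).2, (hmM k).1])) hkl
    · exact h
  exact (hmod δ m M hmM).trans_lt (mul_neg_of_neg_of_pos hxneg hs)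

/-- **A STRICT CUSP TOP IS UNIFORMLY STRICT** (any period pattern function `F`, any extension). All 28 forms of `a`
positive, `T > 0` a period. If `cuspSlope a T δ < 0` for every non-radial `δ` (two distinct rates), then there is ONE
constant `c > 0` with `cuspSlope a T δ ≤ −c·(r_M(δ) − r_m(δ))` for every `δ` and every slowest / fastest pair of its
rates: the descent is uniform in the spread (take `c = −Λ`; the FINITENESS of the normalised rays replaces a compactness
argument on the unit-spread sphere — no topology is imported for it). No direction is asserted to be a strict cusp top. -/
theorem exists_uniform_descent_of_strict {a : Dir} (hpos : ∀ k, 0 < h28 a k) {T : ℝ} (hT : 0 < T)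
    (hper : ∀ k : Fin 28, ∃ z : ℤ, T * h28 a k = z)
    {M : ℕ → Finset (Fin 28)} {f : ℕ → Finset (Fin 28) → ℝ}
    (hf : ∀ m, m + 1 < (bkpts a T).card → ∀ Δ : Fin 8 → ℝ, (∀ k, |phiForm Δ k| < 1) →
      (∀ k, |phiForm Δ k| < wallDist a T) →
        (torusN (bkpt a T m • sParam a + Δ) : ℝ) = f m ((M m).filter fun k => 0 ≤ phiForm Δ k))
    {F : Finset (Fin 28) → ℝ} (hF : ∀ A, F A = ∑ m ∈ Finset.range ((bkpts a T).card - 1), f m (A ∩ M m))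
    (hstrict : ∀ δ : Fin 8 → ℝ, (∃ k l, phiForm δ k / h28 a k ≠ phiForm δ l / h28 a l) → cuspSlope a T δ < 0) :
    ∃ c : ℝ, 0 < c ∧ ∀ δ : Fin 8 → ℝ, ∀ m M : Fin 28, (∀ k, phiForm δ m / h28 a m ≤ phiForm δ k / h28 a k ∧
        phiForm δ k / h28 a k ≤ phiForm δ M / h28 a M) →
      cuspSlope a T δ ≤ -c * (phiForm δ M / h28 a M - phiForm δ m / h28 a m) := by
  obtain ⟨x, -, -, ⟨hxne, -⟩, hmod, -⟩ := exists_modulus_ray hpos hT hper hf hF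
  have hneg := (forall_cuspSlope_neg_iff_modulus_neg hxne hmod).mp hstrict
  exact ⟨-cuspSlope a T x, by linarith, fun δ m M hmM => by rw [neg_neg]; exact hmod δ m M hmM⟩

/-- **`0 ∨ Λ` BOUNDS EVERY CHAMBER ASCENT VALUE.** If `x` carries the modulus bound, then for every reference `δ₀` and
every `δ` in its closed chamber whose selected wall gaps are `≤ 1` (the polytope of P2 g35's `chamber_value_duality`;
its spread is `≤ 1`): `cuspSlope a T δ ≤ max (cuspSlope a T x) 0`. (Conversely the modulus ray itself has rates in
`[0, 1]`, hence selected gaps `≤ 1` in the chamber of any generic refinement: the largest chamber value is `max(Λ, 0)`,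
the two differing exactly at strict cusp tops, where every chamber value is `0` while `Λ < 0`.) -/
theorem cuspSlope_le_max_modulus_zero_of_gaps_le_one {a : Dir} {T : ℝ} {x : Fin 8 → ℝ}
    (hmod : ∀ δ : Fin 8 → ℝ, ∀ m M : Fin 28, (∀ k, phiForm δ m / h28 a m ≤ phiForm δ k / h28 a k ∧
        phiForm δ k / h28 a k ≤ phiForm δ M / h28 a M) →
      cuspSlope a T δ ≤ cuspSlope a T x * (phiForm δ M / h28 a M - phiForm δ m / h28 a m))
    {δ₀ δ : Fin 8 → ℝ} (href : ∀ k l : Fin 28, phiForm δ k / h28 a k < phiForm δ l / h28 a l →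
      phiForm δ₀ k / h28 a k < phiForm δ₀ l / h28 a l)
    (hgap : ∀ k l : Fin 28, phiForm δ₀ k / h28 a k < phiForm δ₀ l / h28 a l →
      phiForm δ l / h28 a l - phiForm δ k / h28 a k ≤ 1) :
    cuspSlope a T δ ≤ max (cuspSlope a T x) 0 := by
  obtain ⟨m, -, hm⟩ := Finset.exists_min_image Finset.univ (fun k => phiForm δ k / h28 a k) Finset.univ_nonempty
  obtain ⟨M, -, hM⟩ := Finset.exists_max_image Finset.univ (fun k => phiForm δ k / h28 a k) Finset.univ_nonempty
  have hmM : ∀ k, phiForm δ m / h28 a m ≤ phiForm δ k / h28 a k ∧ phiForm δ k / h28 a k ≤ phiForm δ M / h28 a M :=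
    fun k => ⟨hm k (Finset.mem_univ _), hM k (Finset.mem_univ _)⟩
  have hs0 : 0 ≤ phiForm δ M / h28 a M - phiForm δ m / h28 a m := by linarith [(hmM m).2]
  -- the spread of `δ` is a selected gap (or zero), hence `≤ 1`
  have hs1 : phiForm δ M / h28 a M - phiForm δ m / h28 a m ≤ 1 := by
    rcases hs0.eq_or_lt with h | h
    · rw [← h]; exact zero_le_one
    · exact hgap m M (href m M (by linarith))
  calc cuspSlope a T δ ≤ cuspSlope a T x * (phiForm δ M / h28 a M - phiForm δ m / h28 a m) := hmod δ m M hmM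
    _ ≤ max (cuspSlope a T x) 0 * (phiForm δ M / h28 a M - phiForm δ m / h28 a m) :=
        mul_le_mul_of_nonneg_right (le_max_left _ _) hs0
    _ ≤ max (cuspSlope a T x) 0 := mul_le_of_le_one_right (le_max_right _ _) hs1

/-! ### Canonical forms: the saving's own period pattern function -/

/-- **THE GLOBAL ASCENT MODULUS — CANONICAL FORM, NO STRUCTURAL HYPOTHESIS.** All 28 forms of `a` positive, `T > 0` a
period, `F = Σ_m patternN a b_m` (P2 g33): there is a normalised ray `x` with `σ(δ) ≤ σ(x)·spread(δ)` for every `δ`,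
`σ(x)` the least such constant and the largest slope of a normalised displacement, `|σ(x)| ≤ T·(2s₀ + 4Σ_j s_j)`.
Inputs: the direction, the period, the saving's own formula. -/
theorem exists_modulus_ray_canonical {a : Dir} (hpos : ∀ k, 0 < h28 a k) {T : ℝ} (hT : 0 < T)
    (hper : ∀ k : Fin 28, ∃ z : ℤ, T * h28 a k = z) {F : Finset (Fin 28) → ℝ}
    (hF : ∀ A, F A = ∑ m ∈ Finset.range ((bkpts a T).card - 1), ((patternN a (bkpt a T m) A : ℤ) : ℝ)) :
    ∃ x : Fin 8 → ℝ, (∀ k, 0 ≤ phiForm x k / h28 a k ∧ phiForm x k / h28 a k ≤ 1) ∧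
      (∃ k l, phiForm x k / h28 a k = 0 ∧ phiForm x l / h28 a l = 1) ∧
      ((∃ k l, phiForm x k / h28 a k ≠ phiForm x l / h28 a l) ∧
        ∀ d : Fin 8 → ℝ, (∀ k l, phiForm x k / h28 a k = phiForm x l / h28 a l →
          phiForm d k / h28 a k = phiForm d l / h28 a l) → ∃ u t : ℝ, d = u • x + t • sParam a) ∧
      (∀ δ : Fin 8 → ℝ, ∀ m M : Fin 28, (∀ k, phiForm δ m / h28 a m ≤ phiForm δ k / h28 a k ∧
          phiForm δ k / h28 a k ≤ phiForm δ M / h28 a M) →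
        cuspSlope a T δ ≤ cuspSlope a T x * (phiForm δ M / h28 a M - phiForm δ m / h28 a m)) ∧
      (∀ c : ℝ, (∀ δ : Fin 8 → ℝ, ∀ m M : Fin 28, (∀ k, phiForm δ m / h28 a m ≤ phiForm δ k / h28 a k ∧
            phiForm δ k / h28 a k ≤ phiForm δ M / h28 a M) →
          cuspSlope a T δ ≤ c * (phiForm δ M / h28 a M - phiForm δ m / h28 a m)) → cuspSlope a T x ≤ c) ∧
      (∀ y : Fin 8 → ℝ, (∀ k, 0 ≤ phiForm y k / h28 a k ∧ phiForm y k / h28 a k ≤ 1) →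
        (∃ k l, phiForm y k / h28 a k = 0 ∧ phiForm y l / h28 a l = 1) → cuspSlope a T y ≤ cuspSlope a T x) ∧
      |cuspSlope a T x| ≤ T * (2 * sParam a 0 + 4 * ∑ j : Fin 7, sParam a j.succ) := by
  classical
  exact exists_modulus_ray hpos hT hper
    (M := fun m => Finset.univ.filter fun k => ∃ z : ℤ, bkpt a T m * h28 a k = z)
    (f := fun m A => ((patternN a (bkpt a T m) A : ℤ) : ℝ)) (canonical_junction_agreement a T)
    (canonical_period_eq_sum_inter hF)

/-- **A STRICT CUSP TOP IS UNIFORMLY STRICT — CANONICAL FORM** (`F = Σ_m patternN a b_m`; hpos / hT / hper / hF and the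
strictness hypothesis only). -/
theorem exists_uniform_descent_of_strict_canonical {a : Dir} (hpos : ∀ k, 0 < h28 a k) {T : ℝ} (hT : 0 < T)
    (hper : ∀ k : Fin 28, ∃ z : ℤ, T * h28 a k = z) {F : Finset (Fin 28) → ℝ}
    (hF : ∀ A, F A = ∑ m ∈ Finset.range ((bkpts a T).card - 1), ((patternN a (bkpt a T m) A : ℤ) : ℝ))
    (hstrict : ∀ δ : Fin 8 → ℝ, (∃ k l, phiForm δ k / h28 a k ≠ phiForm δ l / h28 a l) → cuspSlope a T δ < 0) :
    ∃ c : ℝ, 0 < c ∧ ∀ δ : Fin 8 → ℝ, ∀ m M : Fin 28, (∀ k, phiForm δ m / h28 a m ≤ phiForm δ k / h28 a k ∧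
        phiForm δ k / h28 a k ≤ phiForm δ M / h28 a M) →
      cuspSlope a T δ ≤ -c * (phiForm δ M / h28 a M - phiForm δ m / h28 a m) := by
  classical
  exact exists_uniform_descent_of_strict hpos hT hper
    (M := fun m => Finset.univ.filter fun k => ∃ z : ℤ, bkpt a T m * h28 a k = z)
    (f := fun m A => ((patternN a (bkpt a T m) A : ℤ) : ℝ)) (canonical_junction_agreement a T)
    (canonical_period_eq_sum_inter hF) hstrict

end Summit.KontsevichZagierPeriods.Zeta5Search.Barrier.ConeGamma

end
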